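import Summits.CriticalPhenomena.PercolationContinuityZ3.Theorems.Transplant.PlanarSkeletonFrmQuasiDefs
import Summits.CriticalPhenomena.PercolationContinuityZ3.Theorems.Transplant.SkelFrmQuasiBChoiceReadNums
import Summits.CriticalPhenomena.PercolationContinuityZ3.Theorems.Transplant.SkelFrmBChoiceReadNums
import Summits.CriticalPhenomena.PercolationContinuityZ3.Theorems.Transplant.SkelFrmQuasiBParamsFaceLamA
import Summits.CriticalPhenomena.PercolationContinuityZ3.Theorems.Transplant.SkelFrmBParamsFaceLamA
import Summits.CriticalPhenomena.PercolationContinuityZ3.Theorems.Transplant.SkelNegBParamsFoot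
import Summits.CriticalPhenomena.PercolationContinuityZ3.Theorems.Transplant.SkelNegBParamsReachFC
import Summits.CriticalPhenomena.PercolationContinuityZ3.Theorems.Transplant.SkelFrmQuasi1ParamsLBL
import Summits.CriticalPhenomena.PercolationContinuityZ3.Theorems.Transplant.SkelFrmQuasi1ParamsPO
import Summits.CriticalPhenomena.PercolationContinuityZ3.Theorems.Transplant.SkelFrmQuasiBChoiceWindow
import Summits.CriticalPhenomena.PercolationContinuityZ3.Theorems.Transplant.SkelFrmQuasiBParamsCorrKG
import Summits.CriticalPhenomena.PercolationContinuityZ3.Theorems.Transplant.SkelFrmQuasiBParamsLF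
import Summits.CriticalPhenomena.PercolationContinuityZ3.Theorems.Transplant.SkelFrmQuasiBParamsLFA
import Summits.CriticalPhenomena.PercolationContinuityZ3.Theorems.Transplant.SkelFrmQuasiBParamsSchedA
import HarnessLib
import Summits.CriticalPhenomena.PercolationContinuityZ3.Theorems.Transplant.SkelFrmBChoiceHopFoot
/-!
# GEN-Q PORT (WAVE-Q table v0.8 section 2, row G126, U-level L16; captain R-6/R-7 2026-08-27: carrier token swap `PlanarSkeletonFrmFrom ↦ PlanarSkeletonFrmQuasi`)
# of the tree module «Transplant/SkelFrmFromBChoiceHopFoot» (sha256 a3ce3ca526b751af…) onto the quasi-step carrier `PlanarSkeletonFrmQuasi` (p507026): «SkelFrmQuasiBChoiceHopFoot»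

ORIGINAL TITLE: N2 (frames-only node `SamePDropOfSkeletonFrm₁`, OPEN), (R) value layer — part HopFoot: **THE HOP PRISM'S FINE FOOTPRINT, READ PLANARLY** (J23, design owner

builds on p205010 (kernel theorem, internal audit signed; external expert review pending) — nothing in this file uses p205010; NOTHING is claimed about any open node
((N3-b), the end state).  Lane `prim-bschramm`, seat `prim-bschramm-gen-2` (gen 0; GEN-Q port pen #2 under RULING D-Q / D-Q-2; tool of record port_genq.py of the captain gen-1 g4).  Helper file (`--supports stmt-CriticalPhenomena-4575 --as helper`).
PORT RULES (U-wave r1–r4 re-used, GEN-Q hunk classes of p3-g29 #6136): declaration order, names and proof texts are those of «SkelFrmFromBChoiceHopFoot», byte-identical except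
(i) the carrier token `PlanarSkeletonFrmFrom ↦ PlanarSkeletonFrmQuasi` in binders, `namespace`/`end` lines and qualified names (module names `SkelFrmFrom… ↦ SkelFrmQuasi…`
in imports of already-ported rows); (ii) `Φ.step ↦ Φ.qstep` with the called Steps lemma replaced by its `…Q`/`_q` twin and the cost `Φ.M` threaded (none in this file unless
listed below); (iii) `Φ.cyl_connected ↦ Φ.cyl_reach` readers (none unless listed); (iv) graph-ball radii / window floors ×`Φ.M` (none unless listed).  Carrier-free
residents stay imported/exported from the original «SkelFrmBChoiceHopFoot» exactly as in the FrmFrom port.  Docstrings and citations are the original's.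
HAND HUNKS of this row: none (pure token swap; chart-level hop extents).
-/

noncomputable section

open scoped Classical

namespace Summit.CriticalPhenomena.PercolationContinuityZ3.Theorems.Transplant

open Literature.Probability.Percolation Literature.Probability.LatticeModels SimpleGraph
open TwoAxis.Para (modulus)
open Skelφ (shearUnit kgSL)

namespace PlanarSkeletonFrmQuasi

export PlanarSkeletonNeg.NegB (Aof)  -- T3-auto: resident alias replicated from the FrmFrom namespace
export PlanarSkeletonNeg.Neg (K)  -- T3-auto: resident alias replicated from the FrmFrom namespace
export PlanarSkeletonNeg.NegB (ceil_mul_le)  -- T3-auto: resident alias replicated from the FrmFrom namespace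
export PlanarSkeletonNeg.Neg (forty_le_K)  -- T3-auto: resident alias replicated from the FrmFrom namespace

namespace NegB

open SkelConc (Consts)
open Neg

section HopFoot

variable (κ : Consts) {V : Type} [DecidableEq V] [Countable V] {G : SimpleGraph V} [G.LocallyFinite] (Φ : PlanarSkeletonFrmQuasi G) (t : V) (p : unitInterval)
  (D : Skelφ.StepI.DataNS V) (g f : ℕ)

/-! ## §1 The planar reading of the fine map on a long parallelogram cylinder -/

/-- **`khop₀ L := ⌈c₀·|A|·(m + n_L·L)/D_A⌉`** (floor + 1): the along fine half-extent of `pgramCyl φ′ t n_L h_L L`. [this work] -/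
def khop₀ (κ : Consts) {V : Type} [DecidableEq V] [Countable V] {G : SimpleGraph V} [G.LocallyFinite] (Φ : PlanarSkeletonFrmQuasi G) (t : V) (p : unitInterval) (D : Skelφ.StepI.DataNS V) (g : ℕ) (f : ℕ) (L : ℕ) : ℤ :=
  (prFA κ Φ t p D g f).c₀ * (|(prFA κ Φ t p D g f).A| *
    (modulus (nL κ Φ t p D g f) (hL κ Φ t p D g f) (vL κ Φ t p D g f) (vβL κ Φ t p D g f) + (nL κ Φ t p D g f : ℤ) * L)) / (prFA κ Φ t p D g f).D + 1

/-- **`khop₁ L := ⌈c₁·|A|·(n_L·L)/D_A⌉`** (floor + 1): the across fine half-extent of `pgramCyl φ′ t n_L h_L L`. [this work] -/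
def khop₁ (κ : Consts) {V : Type} [DecidableEq V] [Countable V] {G : SimpleGraph V} [G.LocallyFinite] (Φ : PlanarSkeletonFrmQuasi G) (t : V) (p : unitInterval) (D : Skelφ.StepI.DataNS V) (g : ℕ) (f : ℕ) (L : ℕ) : ℤ :=
  (prFA κ Φ t p D g f).c₁ * (|(prFA κ Φ t p D g f).A| * ((nL κ Φ t p D g f : ℤ) * L)) / (prFA κ Φ t p D g f).D + 1

/-- **THE HOP PRISM READ PLANARLY** (any map `φ′`, any height `L`): `w ∈ pgramCyl φ′ t n_L h_L L ⇒ |fineA … φ′ w 0| ≤ khop₀ L ∧ |fineA … φ′ w 1| ≤ khop₁ L`.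
[cite: KozmaNitzan2024, §4 pp. 25–26] -/
theorem hkR_hop (κ : Consts) {V : Type} [DecidableEq V] [Countable V] {G : SimpleGraph V} [G.LocallyFinite] (Φ : PlanarSkeletonFrmQuasi G) (t : V) (p : unitInterval) (D : Skelφ.StepI.DataNS V) (g : ℕ) (f : ℕ) (hN : EqNumL κ Φ t p D g f) {φ' : V → Site 2} {L : ℕ} {w : V}
    (hw : w ∈ Skelφ.pgramCyl φ' t (nL κ Φ t p D g f) (hL κ Φ t p D g f) L) :
    |fineA κ Φ t p D g f φ' w 0| ≤ khop₀ κ Φ t p D g f L ∧ |fineA κ Φ t p D g f φ' w 1| ≤ khop₁ κ Φ t p D g f L := by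
  obtain ⟨hA, hn1, hm, hc₀, hc₁, hD⟩ := KS.prFA_pos κ Φ t p D g f hN
  have hvβ : vβL κ Φ t p D g f = Skelφ.NegPrm.vβOf (nL κ Φ t p D g f) (hL κ Φ t p D g f) (ℓL κ Φ t p D g f) (vL κ Φ t p D g f) := rfl
  obtain ⟨h0, h1⟩ := Skelφ.lam_bounds_of_mem_pgramCyl (φ := φ') (one_le_of_eqNumL κ Φ t p D g f hN).1 hN.v_le (le_of_lt hm) hw
  have hL0 := PlanarSkeletonNeg.NegB.ceil_mul_le (x := (prFA κ Φ t p D g f).c₀ * (|(prFA κ Φ t p D g f).A| *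
    (modulus (nL κ Φ t p D g f) (hL κ Φ t p D g f) (vL κ Φ t p D g f) (vβL κ Φ t p D g f) + (nL κ Φ t p D g f : ℤ) * L))) hD
  have hL1 := PlanarSkeletonNeg.NegB.ceil_mul_le (x := (prFA κ Φ t p D g f).c₁ * (|(prFA κ Φ t p D g f).A| * ((nL κ Φ t p D g f : ℤ) * L))) hD
  rw [mul_comm ((prFA κ Φ t p D g f).D)] at hL0 hL1
  have key := Skelφ.abs_fineSkel_le_of_lam₂ (φ := φ') t hD hc₀.le hc₁.le hL0 hL1 h0 h1
  rw [fineA_eq, Skelφ.NegPrm.fineA_eq, ← hvβ]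
  exact key

/-- The skeletons' binder shape: over `pgramPrismFin … (3ℓ_L) R` (any fibre radius `R`). [folklore] -/
theorem hkR_hop_prism (κ : Consts) {V : Type} [DecidableEq V] [Countable V] {G : SimpleGraph V} [G.LocallyFinite] (Φ : PlanarSkeletonFrmQuasi G) (t : V) (p : unitInterval) (D : Skelφ.StepI.DataNS V) (g : ℕ) (f : ℕ) (hN : EqNumL κ Φ t p D g f) {φ' : V → Site 2} {R : ℕ} :
    ∀ w ∈ Skelφ.pgramPrismFin G φ' t (nL κ Φ t p D g f) (hL κ Φ t p D g f) (3 * ℓL κ Φ t p D g f) R,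
      |fineA κ Φ t p D g f φ' w 0| ≤ khop₀ κ Φ t p D g f (3 * ℓL κ Φ t p D g f) ∧ |fineA κ Φ t p D g f φ' w 1| ≤ khop₁ κ Φ t p D g f (3 * ℓL κ Φ t p D g f) :=
  fun _ hw => hkR_hop κ Φ t p D g f hN ((Skelφ.mem_pgramPrism G φ').1 ((Skelφ.mem_pgramPrismFin G φ').1 hw)).2

/-! ## §2 The floors -/

/-- `3·n_L·ℓ_L ≤ 4·m` (`U·sL ≤ m`, `n_Lℓ_L ≤ U·sL + 2U`, `6U ≤ U·sL` from `958 ≤ M_L − 1 ≤ sL`). [folklore] -/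
theorem three_nℓ_le_four_modulus (κ : Consts) {V : Type} [DecidableEq V] [Countable V] {G : SimpleGraph V} [G.LocallyFinite] (Φ : PlanarSkeletonFrmQuasi G) (t : V) (p : unitInterval) (D : Skelφ.StepI.DataNS V) (g : ℕ) (f : ℕ) (hN : EqNumL κ Φ t p D g f) :
    3 * ((nL κ Φ t p D g f : ℤ) * (ℓL κ Φ t p D g f : ℤ)) ≤
      4 * modulus (nL κ Φ t p D g f) (hL κ Φ t p D g f) (vL κ Φ t p D g f) (vβL κ Φ t p D g f) := by
  have hm := UsL_le_modulus κ Φ t p D g f hN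
  have hsL := ML_sub_one_le_kgSL κ Φ t p D g f hN
  have h960 := slack_floor_le_ML κ Φ t p D g
  have hn1 := (one_le_of_eqNumL κ Φ t p D g f hN).1
  have hU0 : (0 : ℤ) < (shearUnit (nL κ Φ t p D g f) (hL κ Φ t p D g f) : ℕ) := Skelφ.shearUnit_pos hn1 _
  -- `U·sL ≥ nℓ − 2U + 2` from the floor division
  have hfl : ((shearUnit (nL κ Φ t p D g f) (hL κ Φ t p D g f) : ℕ) : ℤ) * kgSL (nL κ Φ t p D g f) (ℓL κ Φ t p D g f) (hL κ Φ t p D g f) ≥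
      (nL κ Φ t p D g f : ℤ) * ℓL κ Φ t p D g f - 2 * (shearUnit (nL κ Φ t p D g f) (hL κ Φ t p D g f) : ℕ) + 2 := by
    unfold Skelφ.kgSL
    have := Int.lt_mul_ediv_self_add (x := (nL κ Φ t p D g f : ℤ) * ℓL κ Φ t p D g f - (shearUnit (nL κ Φ t p D g f) (hL κ Φ t p D g f) : ℕ) + 1) hU0
    linarith
  have h960' : (958 : ℤ) ≤ kgSL (nL κ Φ t p D g f) (ℓL κ Φ t p D g f) (hL κ Φ t p D g f) := by
    have : (960 : ℤ) ≤ (ML κ Φ t p D g : ℤ) + 1 := by exact_mod_cast h960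
    linarith
  have h6 : 6 * ((shearUnit (nL κ Φ t p D g f) (hL κ Φ t p D g f) : ℕ) : ℤ) ≤
      ((shearUnit (nL κ Φ t p D g f) (hL κ Φ t p D g f) : ℕ) : ℤ) * kgSL (nL κ Φ t p D g f) (ℓL κ Φ t p D g f) (hL κ Φ t p D g f) := by nlinarith
  linarith

/-- **The two half-extents at `L := 3ℓ_L`**: `khop₀ (3ℓ_L) ≤ 5·s₀ + 1`, `khop₁ (3ℓ_L) ≤ 4·s₁ + 1`. [folklore] -/
theorem khop_floors (κ : Consts) {V : Type} [DecidableEq V] [Countable V] {G : SimpleGraph V} [G.LocallyFinite] (Φ : PlanarSkeletonFrmQuasi G) (t : V) (p : unitInterval) (D : Skelφ.StepI.DataNS V) (g : ℕ) (f : ℕ) (hN : EqNumL κ Φ t p D g f) :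
    khop₀ κ Φ t p D g f (3 * ℓL κ Φ t p D g f) ≤ 5 * (((fcellsA κ Φ t p D g f).s 0 : ℕ) : ℤ) + 1 ∧
      khop₁ κ Φ t p D g f (3 * ℓL κ Φ t p D g f) ≤ 4 * (((fcellsA κ Φ t p D g f).s 1 : ℕ) : ℤ) + 1 := by
  obtain ⟨hAe, hA0, hDe, hc0e, hc1e, hm0, hne, -⟩ := prFA_ids κ Φ t p D g f hN
  have hD : 0 < (prFA κ Φ t p D g f).D := (KS.prFA_pos κ Φ t p D g f hN).2.2.2.2.2
  have h34 := three_nℓ_le_four_modulus κ Φ t p D g f hN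
  rw [hne] at hm0 hDe
  have hvα : (prFA κ Φ t p D g f).vα = vL κ Φ t p D g f := rfl
  have hvβ : (prFA κ Φ t p D g f).vβ = vβL κ Φ t p D g f := rfl
  have hh : (prFA κ Φ t p D g f).h = hL κ Φ t p D g f := rfl
  rw [hvα, hvβ, hh] at hm0 hDe
  set m : ℤ := modulus (nL κ Φ t p D g f) (hL κ Φ t p D g f) (vL κ Φ t p D g f) (vβL κ Φ t p D g f) with hm_def
  have hs0 : (0 : ℤ) ≤ (((fcellsA κ Φ t p D g f).s 0 : ℕ) : ℤ) := by positivity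
  have hs1 : (0 : ℤ) ≤ (((fcellsA κ Φ t p D g f).s 1 : ℕ) : ℤ) := by positivity
  have hA2 : (0 : ℤ) < Aof κ ^ 2 := by positivity
  have habs : |Aof κ| = Aof κ := abs_of_pos hA0
  have hℓ3 : ((3 * ℓL κ Φ t p D g f : ℕ) : ℤ) = 3 * (ℓL κ Φ t p D g f : ℤ) := by push_cast; ring
  constructor
  · unfold khop₀
    rw [hc0e, hAe, habs, hDe, hℓ3]
    have hx : Aof κ * (((fcellsA κ Φ t p D g f).s 0 : ℕ) : ℤ) * (Aof κ * (m + (nL κ Φ t p D g f : ℤ) * (3 * (ℓL κ Φ t p D g f : ℤ)))) ≤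
        (5 * (((fcellsA κ Φ t p D g f).s 0 : ℕ) : ℤ)) * (Aof κ ^ 2 * m) := by
      have h5 : m + (nL κ Φ t p D g f : ℤ) * (3 * (ℓL κ Φ t p D g f : ℤ)) ≤ 5 * m := by linarith
      have := mul_le_mul_of_nonneg_left h5 (mul_nonneg hA2.le hs0)
      nlinarith
    have := Int.ediv_le_of_le_mul (by positivity : (0 : ℤ) < Aof κ ^ 2 * m) hx
    linarith
  · unfold khop₁
    rw [hc1e, hAe, habs, hDe, hℓ3]
    have hx : Aof κ * (((fcellsA κ Φ t p D g f).s 1 : ℕ) : ℤ) * (Aof κ * ((nL κ Φ t p D g f : ℤ) * (3 * (ℓL κ Φ t p D g f : ℤ)))) ≤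
        (4 * (((fcellsA κ Φ t p D g f).s 1 : ℕ) : ℤ)) * (Aof κ ^ 2 * m) := by
      have h4 : (nL κ Φ t p D g f : ℤ) * (3 * (ℓL κ Φ t p D g f : ℤ)) ≤ 4 * m := by linarith
      have := mul_le_mul_of_nonneg_left h4 (mul_nonneg hA2.le hs1)
      nlinarith
    have := Int.ediv_le_of_le_mul (by positivity : (0 : ℤ) < Aof κ ^ 2 * m) hx
    linarith

/-- **`hfR` FOR THE FIRST AXIS** (`∥ := 0`, `⊥ := 1`): `khop₀ (3ℓ_L) + 1 ≤ 5·r₀` and, for any transverse creep `c₀ ≤ r₁`, `khop₁ (3ℓ_L) + 2 + c₀ ≤ 5·r₁`. [folklore] -/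
theorem hfR_hop_fst (κ : Consts) {V : Type} [DecidableEq V] [Countable V] {G : SimpleGraph V} [G.LocallyFinite] (Φ : PlanarSkeletonFrmQuasi G) (t : V) (p : unitInterval) (D : Skelφ.StepI.DataNS V) (g : ℕ) (f : ℕ) (hN : EqNumL κ Φ t p D g f) {c₀ : ℤ} (hc : c₀ ≤ ((fcellsA κ Φ t p D g f).r 1 : ℤ)) :
    khop₀ κ Φ t p D g f (3 * ℓL κ Φ t p D g f) + 1 ≤ 5 * ((fcellsA κ Φ t p D g f).r 0 : ℤ) ∧
      khop₁ κ Φ t p D g f (3 * ℓL κ Φ t p D g f) + 2 + c₀ ≤ 5 * ((fcellsA κ Φ t p D g f).r 1 : ℤ) := by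
  obtain ⟨h0, h1⟩ := khop_floors κ Φ t p D g f hN
  have hK : (40 : ℤ) ≤ Neg.K κ := by exact_mod_cast (Neg.forty_le_K κ).1
  have hr0 : ((fcellsA κ Φ t p D g f).r 0 : ℤ) = Neg.K κ * (((fcellsA κ Φ t p D g f).s 0 : ℕ) : ℤ) := by
    exact_mod_cast (fcellsA_K κ Φ t p D g f).2.2 0
  have hr1 : ((fcellsA κ Φ t p D g f).r 1 : ℤ) = Neg.K κ * (((fcellsA κ Φ t p D g f).s 1 : ℕ) : ℤ) := by
    exact_mod_cast (fcellsA_K κ Φ t p D g f).2.2 1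
  have hs0 : (1 : ℤ) ≤ (((fcellsA κ Φ t p D g f).s 0 : ℕ) : ℤ) := by exact_mod_cast (fcellsA κ Φ t p D g f).hs 0
  have hs1 : (1 : ℤ) ≤ (((fcellsA κ Φ t p D g f).s 1 : ℕ) : ℤ) := by exact_mod_cast (fcellsA κ Φ t p D g f).hs 1
  rw [hr1] at hc
  rw [hr0, hr1]
  constructor <;> nlinarith

/-- **`hfR` FOR THE SECOND AXIS** (`∥ := 1`, `⊥ := 0`): `khop₁ (3ℓ_L) + 1 ≤ 5·r₁` and, for any creep `c₁ ≤ r₀`, `khop₀ (3ℓ_L) + 2 + c₁ ≤ 5·r₀`. [folklore] -/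
theorem hfR_hop_snd (κ : Consts) {V : Type} [DecidableEq V] [Countable V] {G : SimpleGraph V} [G.LocallyFinite] (Φ : PlanarSkeletonFrmQuasi G) (t : V) (p : unitInterval) (D : Skelφ.StepI.DataNS V) (g : ℕ) (f : ℕ) (hN : EqNumL κ Φ t p D g f) {c₁ : ℤ} (hc : c₁ ≤ ((fcellsA κ Φ t p D g f).r 0 : ℤ)) :
    khop₁ κ Φ t p D g f (3 * ℓL κ Φ t p D g f) + 1 ≤ 5 * ((fcellsA κ Φ t p D g f).r 1 : ℤ) ∧
      khop₀ κ Φ t p D g f (3 * ℓL κ Φ t p D g f) + 2 + c₁ ≤ 5 * ((fcellsA κ Φ t p D g f).r 0 : ℤ) := by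
  obtain ⟨h0, h1⟩ := khop_floors κ Φ t p D g f hN
  have hK : (40 : ℤ) ≤ Neg.K κ := by exact_mod_cast (Neg.forty_le_K κ).1
  have hr0 : ((fcellsA κ Φ t p D g f).r 0 : ℤ) = Neg.K κ * (((fcellsA κ Φ t p D g f).s 0 : ℕ) : ℤ) := by
    exact_mod_cast (fcellsA_K κ Φ t p D g f).2.2 0
  have hr1 : ((fcellsA κ Φ t p D g f).r 1 : ℤ) = Neg.K κ * (((fcellsA κ Φ t p D g f).s 1 : ℕ) : ℤ) := by
    exact_mod_cast (fcellsA_K κ Φ t p D g f).2.2 1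
  have hs0 : (1 : ℤ) ≤ (((fcellsA κ Φ t p D g f).s 0 : ℕ) : ℤ) := by exact_mod_cast (fcellsA κ Φ t p D g f).hs 0
  have hs1 : (1 : ℤ) ≤ (((fcellsA κ Φ t p D g f).s 1 : ℕ) : ℤ) := by exact_mod_cast (fcellsA κ Φ t p D g f).hs 1
  rw [hr0] at hc
  rw [hr0, hr1]
  constructor <;> nlinarith

end HopFoot

end NegB

end PlanarSkeletonFrmQuasi

end Summit.CriticalPhenomena.PercolationContinuityZ3.Theorems.Transplant

end
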